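import Literature.IUT.LogVolume.HaarTransport
import Literature.IUT.LogVolume.LogShellTopology
import HarnessLib

/-!
# (Ind2) at a finite prime, concretely: lattice isomorphisms of the log-shell `log_p(𝒪_K^×)` — and of
# its scalings `c · log_p(𝒪_K^×)` (`I_K = (p*)⁻¹·log_p(𝒪_K^×)`, Dupuy–Hilado's `(2p)⁻¹·log(𝒪^×)`) —
# preserve the volume `μ_K`

Dupuy–Hilado, *The statement of Mochizuki's Corollary 3.12…*, arXiv:2004.13228 (pre-split text), §4.9
"(`p`-adic Ind2)", read on the page: "These indeterminacies are referred to as "isometries" in [IUT2].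
[footnote: Invertible linear maps on finite dimensional `ℚ_p`-vector spaces have determinant one. This
means the distortion factor (the determinant) is 1 and the measure of sets are preserved under these maps.]
They act through the group `Aut_{ℚ_p}(K_{v⃗} : I_{v⃗}) = {φ ∈ Vect_{ℚ_p}(K_{v⃗}, K_{v⃗}) : φ(I_{v⃗}) ⊂ I_{v⃗}}`.
Another way to see these are as `ℚ_p`-vector space automorphisms which arise as `ℤ_p`-lattice isomorphisms
of `I_{v̲}`"; §4 intro: "`I_{v̲} = (1/2p_{v̲}) log(O^×_{v̲})`. The `I_{v̲}` are Mochizuki's so-called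
log-shells"; [IUTchIII] Rmk. 1.2.2 (i) (kurims p. 36): "`I_k := (p*)⁻¹ · log_k(O_k^×)`"; [IUTchIII]
Thm. 3.11 (i) (Ind2) (p. 154) / Cor. 3.12 proof Step (x) (p. 181): the log-volumes "are invariant with
respect to the indeterminacies (Ind1), (Ind2)".

This file makes the footnote a THEOREM for ONE tensor factor (`|I| = 1`), with the real `p`-adic logarithm
of the campaign (`Literature.IUT.LogVolume.unitLog`, `logUnits K = log_p(𝒪_K^×)`; abc-iut-S1's
`LogShellTopology.lean` proves it is a COMPACT OPEN additive subgroup of `K`): by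
`IntegralStructure.haar_image_of_preserves` (`HaarTransport.lean`: an additive homeomorphism of `K` mapping
SOME compact open subgroup onto itself preserves EVERY normalised Haar measure),

* `localVolume_image_of_image_addSubgroup_eq` — any additive homeomorphism `φ` of a nonarchimedean local
  field with `φ(S) = S` for some compact open additive subgroup `S` satisfies `μ_K(φ(A)) = μ_K(A)` for
  all `A` (and the `μ^log`, normalised-`μ^log` forms); `…_of_addEquiv` — the same for a bicontinuous
  additive (e.g. `ℚ`- or `ℚ_p`-linear) automorphism given as `K ≃+ K` plus two continuity proofs, the
  shape of the cell's `Thm311RealDH.ismDH` ("bicontinuous `ℚ`-linear `φ` with `φ '' I_v = I_v`");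
* `localVolume_image_of_image_logUnits_eq` — (Ind2) for the lattice `log_p(𝒪_K^×)` itself;
* `localVolume_image_of_image_smul_logUnits_eq` — (Ind2) for every scaled lattice `c·log_p(𝒪_K^×)`,
  `c ≠ 0` (so for `I_K = (p*)⁻¹·log_p(𝒪_K^×)` and for Dupuy–Hilado's `(2p)⁻¹·log(𝒪^×)`), via
  `smul_logUnits_isCompact` / `smul_logUnits_isOpen` (images under the homeomorphism `x ↦ c·x`).

HONEST SCOPE. (1) One factor only: the tensor-packet lattice `I_{v⃗} = I_{v̲_0} ⊗ ⋯ ⊗ I_{v̲_j}` needs the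
topologised tensor packet (campaign-S files in progress); the argument there is the same lemma
`haar_image_of_preserves` once `I_{v⃗}` is known to be a compact open subgroup of `K_{v⃗}`. (2) The printed
"`φ(I_{v⃗}) ⊂ I_{v⃗}`" must be read, as the text's next sentence does, as a lattice ISOMORPHISM
`φ(I) = I`: an automorphism with `φ(I) ⊊ I` (e.g. `x ↦ p·x`) does NOT preserve measure — the hypotheses
below are equalities. (3) With an ABSTRACT logarithm (a bare homomorphism `𝒪_K^× → K`, as in the binder
`logv` of the cell's `Thm311Real`) the "shell" need not be open (e.g. `{0}` for the zero homomorphism) and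
no volume statement follows; the theorems here are about the analytic `log_p`.
[cite: DupuyHilado2025, §4.9] Deliberately NOT here: (Ind1) (tensor-factor permutations: `haar_image_equiv`
once the packet is topologised), archimedean `{±1}` (`IntegralStructure.haar_neg`), any judgement on
[IUTchIII] Cor. 3.12.
-/

noncomputable section

open MeasureTheory Set Metric
open scoped Pointwise

namespace Literature.IUT.LogVolume

/-! ### Lattice automorphisms of a nonarchimedean local field preserve its volume -/

section General

variable (K : Type*) [NontriviallyNormedField K] [IsUltrametricDist K] [ProperSpace K]
  [MeasurableSpace K] [BorelSpace K]

/-- **(Ind2), abstract form on one local field**: an additive homeomorphism `φ` of `K` that maps SOME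
compact open additive subgroup `S` ("a `ℤ_p`-lattice") onto itself preserves the volume:
`μ_K(φ(A)) = μ_K(A)` for every `A ⊆ K`. [cite: DupuyHilado2025, §4.9] -/
theorem localVolume_image_of_image_addSubgroup_eq (S : AddSubgroup K) (hSo : IsOpen (S : Set K))
    (hSc : IsCompact (S : Set K)) (φ : K ≃ₜ+ K) (hφ : φ '' (S : Set K) = (S : Set K)) (A : Set K) :
    localVolume K (φ '' A) = localVolume K A :=
  localVolume_image_of_preserves K φ ⟨⟨S, hSo⟩, hSc⟩ hφ A

/-- Log form: `μ^log_K(φ(A)) = μ^log_K(A)` for such `φ`. [cite: DupuyHilado2025, §4.9] -/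
theorem localLogVolume_image_of_image_addSubgroup_eq (S : AddSubgroup K) (hSo : IsOpen (S : Set K))
    (hSc : IsCompact (S : Set K)) (φ : K ≃ₜ+ K) (hφ : φ '' (S : Set K) = (S : Set K)) (A : Set K) :
    localLogVolume K (φ '' A) = localLogVolume K A :=
  localLogVolume_image_of_preserves K φ ⟨⟨S, hSo⟩, hSc⟩ hφ A

/-- Normalised log form (weight `d`, e.g. `[K:ℚ_p]`): `μ^log(φ(A)) = μ^log(A)` for such `φ`.
[cite: DupuyHilado2025, §4.9] -/
theorem normalizedLocalLogVolume_image_of_image_addSubgroup_eq (d : ℕ) (S : AddSubgroup K)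
    (hSo : IsOpen (S : Set K)) (hSc : IsCompact (S : Set K)) (φ : K ≃ₜ+ K)
    (hφ : φ '' (S : Set K) = (S : Set K)) (A : Set K) :
    normalizedLocalLogVolume K d (φ '' A) = normalizedLocalLogVolume K d A :=
  normalizedLocalLogVolume_image_of_preserves K d φ ⟨⟨S, hSo⟩, hSc⟩ hφ A

/-- The same for an automorphism presented as a BICONTINUOUS ADDITIVE EQUIVALENCE — the shape in which
(Ind2) is typed on the summit side (a `ℚ`-linear `φ : K_v ≃ K_v` with `φ`, `φ⁻¹` continuous and
`φ(I_v) = I_v`; use `φ.toAddEquiv`). [cite: DupuyHilado2025, §4.9] -/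
theorem localVolume_image_of_addEquiv (S : AddSubgroup K) (hSo : IsOpen (S : Set K))
    (hSc : IsCompact (S : Set K)) (φ : K ≃+ K) (h₁ : Continuous φ) (h₂ : Continuous φ.symm)
    (hφ : φ '' (S : Set K) = (S : Set K)) (A : Set K) :
    localVolume K (φ '' A) = localVolume K A :=
  localVolume_image_of_image_addSubgroup_eq K S hSo hSc
    { φ with continuous_toFun := h₁, continuous_invFun := h₂ } hφ A

/-- Log form of `localVolume_image_of_addEquiv`. [cite: DupuyHilado2025, §4.9] -/
theorem localLogVolume_image_of_addEquiv (S : AddSubgroup K) (hSo : IsOpen (S : Set K))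
    (hSc : IsCompact (S : Set K)) (φ : K ≃+ K) (h₁ : Continuous φ) (h₂ : Continuous φ.symm)
    (hφ : φ '' (S : Set K) = (S : Set K)) (A : Set K) :
    localLogVolume K (φ '' A) = localLogVolume K A :=
  localLogVolume_image_of_image_addSubgroup_eq K S hSo hSc
    { φ with continuous_toFun := h₁, continuous_invFun := h₂ } hφ A

end General

/-! ### The log-shell lattices `log_p(𝒪_K^×)` and `c · log_p(𝒪_K^×)` -/

section LogShell

variable (p : ℕ) [Fact p.Prime]
variable (K : Type*) [NontriviallyNormedField K] [instK : NormedAlgebra ℚ_[p] K] [IsUltrametricDist K]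
  [ProperSpace K]

include instK

/-- **(Ind2) for the lattice `log_p(𝒪_K^×)`**: an additive homeomorphism of `K` mapping `log_p(𝒪_K^×)` onto
itself preserves the volume `μ_K` (`log_p(𝒪_K^×)` is a compact open additive subgroup:
`isCompact_logUnits`, `isOpen_logUnits`, `logUnitsAddSubgroup`). [cite: DupuyHilado2025, §4.9] -/
theorem localVolume_image_of_image_logUnits_eq [MeasurableSpace K] [BorelSpace K] (φ : K ≃ₜ+ K)
    (hφ : φ '' logUnits K = logUnits K) (A : Set K) : localVolume K (φ '' A) = localVolume K A :=
  localVolume_image_of_image_addSubgroup_eq K (logUnitsAddSubgroup p K) (isOpen_logUnits p K)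
    (isCompact_logUnits p K) φ hφ A

/-- Log form: `μ^log_K(φ(A)) = μ^log_K(A)` for a lattice automorphism of `log_p(𝒪_K^×)`.
[cite: DupuyHilado2025, §4.9] -/
theorem localLogVolume_image_of_image_logUnits_eq [MeasurableSpace K] [BorelSpace K] (φ : K ≃ₜ+ K)
    (hφ : φ '' logUnits K = logUnits K) (A : Set K) : localLogVolume K (φ '' A) = localLogVolume K A :=
  localLogVolume_image_of_image_addSubgroup_eq K (logUnitsAddSubgroup p K) (isOpen_logUnits p K)
    (isCompact_logUnits p K) φ hφ A

/-- The scaled lattice `c · log_p(𝒪_K^×)` (`c ≠ 0`) is the image of `log_p(𝒪_K^×)` under the additive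
homeomorphism `x ↦ c·x`; as an additive subgroup. [cite: DupuyHilado2025, §4.9] -/
theorem coe_map_mulLeft_logUnitsAddSubgroup (c : K) :
    ((logUnitsAddSubgroup p K).map (AddMonoidHom.mulLeft c) : Set K) = c • logUnits K := by
  rw [AddSubgroup.coe_map]
  rfl

/-- `c · log_p(𝒪_K^×)` is compact. [cite: DupuyHilado2025, §4.9] -/
theorem smul_logUnits_isCompact (c : K) : IsCompact (c • logUnits K) := by
  rw [← Set.image_smul]
  exact (isCompact_logUnits p K).image (continuous_const_smul c)

/-- `c · log_p(𝒪_K^×)` is open for `c ≠ 0` (image of an open set under the homeomorphism `x ↦ c·x`).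
[cite: DupuyHilado2025, §4.9] -/
theorem smul_logUnits_isOpen {c : K} (hc : c ≠ 0) : IsOpen (c • logUnits K) := by
  rw [← Set.image_smul]
  exact (Homeomorph.mulLeft₀ c hc).isOpenMap _ (isOpen_logUnits p K)

/-- `c · log_p(𝒪_K^×)` (`c ≠ 0`) is an integral structure (compact open additive subgroup) of `K`; stated
as an existence so that this file stays definition-free. [cite: DupuyHilado2025, §4.9] -/
theorem exists_integralStructure_coe_eq_smul_logUnits {c : K} (hc : c ≠ 0) :
    ∃ Λ₀ : IntegralStructure K, (Λ₀ : Set K) = c • logUnits K := by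
  have h := coe_map_mulLeft_logUnitsAddSubgroup p K c
  refine ⟨⟨⟨(logUnitsAddSubgroup p K).map (AddMonoidHom.mulLeft c), ?_⟩, ?_⟩, ?_⟩
  · change IsOpen (((logUnitsAddSubgroup p K).map (AddMonoidHom.mulLeft c) : AddSubgroup K) : Set K)
    rw [h]; exact smul_logUnits_isOpen p K hc
  · change IsCompact (((logUnitsAddSubgroup p K).map (AddMonoidHom.mulLeft c) : AddSubgroup K) : Set K)
    rw [h]; exact smul_logUnits_isCompact p K c
  · change (((logUnitsAddSubgroup p K).map (AddMonoidHom.mulLeft c) : AddSubgroup K) : Set K) = _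
    exact h

/-- **(Ind2) for the log-shell `I_K = c · log_p(𝒪_K^×)`** (`c = (p*)⁻¹` in [IUTchIII] Rmk. 1.2.2 (i),
`c = (2p)⁻¹` in Dupuy–Hilado §4; any `c ≠ 0`): an additive homeomorphism `φ` of `K` with `φ(I_K) = I_K`
preserves the volume, `μ_K(φ(A)) = μ_K(A)` for every `A` — "the measure of sets are preserved under these
maps", for the real `p`-adic logarithm. [cite: DupuyHilado2025, §4.9] -/
theorem localVolume_image_of_image_smul_logUnits_eq [MeasurableSpace K] [BorelSpace K] {c : K}
    (hc : c ≠ 0) (φ : K ≃ₜ+ K) (hφ : φ '' (c • logUnits K) = c • logUnits K) (A : Set K) :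
    localVolume K (φ '' A) = localVolume K A := by
  obtain ⟨Λ₀, hΛ₀⟩ := exists_integralStructure_coe_eq_smul_logUnits p K hc
  exact localVolume_image_of_preserves K φ Λ₀ (by rw [hΛ₀]; exact hφ) A

/-- Log form: `μ^log_K(φ(A)) = μ^log_K(A)` for a lattice automorphism of `I_K = c · log_p(𝒪_K^×)`.
[cite: DupuyHilado2025, §4.9] -/
theorem localLogVolume_image_of_image_smul_logUnits_eq [MeasurableSpace K] [BorelSpace K] {c : K}
    (hc : c ≠ 0) (φ : K ≃ₜ+ K) (hφ : φ '' (c • logUnits K) = c • logUnits K) (A : Set K) :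
    localLogVolume K (φ '' A) = localLogVolume K A := by
  obtain ⟨Λ₀, hΛ₀⟩ := exists_integralStructure_coe_eq_smul_logUnits p K hc
  exact localLogVolume_image_of_preserves K φ Λ₀ (by rw [hΛ₀]; exact hφ) A

/-- Normalised log form (weight `d`, e.g. `[K:ℚ_p]`): `μ^log(φ(A)) = μ^log(A)` for a lattice
automorphism of `I_K = c · log_p(𝒪_K^×)`. [cite: DupuyHilado2025, §4.9] -/
theorem normalizedLocalLogVolume_image_of_image_smul_logUnits_eq [MeasurableSpace K] [BorelSpace K]
    (d : ℕ) {c : K} (hc : c ≠ 0) (φ : K ≃ₜ+ K) (hφ : φ '' (c • logUnits K) = c • logUnits K)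
    (A : Set K) : normalizedLocalLogVolume K d (φ '' A) = normalizedLocalLogVolume K d A := by
  obtain ⟨Λ₀, hΛ₀⟩ := exists_integralStructure_coe_eq_smul_logUnits p K hc
  exact normalizedLocalLogVolume_image_of_preserves K d φ Λ₀ (by rw [hΛ₀]; exact hφ) A

/-- The `K ≃+ K` form for the log-shell `I_K = c · log_p(𝒪_K^×)`: a bicontinuous additive automorphism
with `φ(I_K) = I_K` preserves `μ_K` — exactly the membership condition of the summit side's (Ind2) set
at a finite place, for the analytic logarithm. [cite: DupuyHilado2025, §4.9] -/
theorem localVolume_image_of_addEquiv_smul_logUnits [MeasurableSpace K] [BorelSpace K] {c : K}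
    (hc : c ≠ 0) (φ : K ≃+ K) (h₁ : Continuous φ) (h₂ : Continuous φ.symm)
    (hφ : φ '' (c • logUnits K) = c • logUnits K) (A : Set K) :
    localVolume K (φ '' A) = localVolume K A :=
  localVolume_image_of_image_smul_logUnits_eq p K hc
    { φ with continuous_toFun := h₁, continuous_invFun := h₂ } hφ A

end LogShell

end Literature.IUT.LogVolume

end
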